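import Literature.NumberTheory.EllipticCurves.Gamma0AwayPingPong
import HarnessLib

/-!
# Generation: `Γ₀(L′; ℤ[1/t])` is generated by `ιΓ₀(L′)` and `θ(ιΓ₀(L′))` (`t ∤ L′`)

Topic `Literature/NumberTheory/EllipticCurves` (supporting the named fact
`gamma0Away_character_extension_of_shiftInvariant`; sub-namespace `Gamma0Away`; continues
`Gamma0AwayTreeCoordinates.lean` / `Gamma0AwayPingPong.lean`).  Theorems only.  For a prime `t`, `t ∤ L′`, and a
subgroup `S ≤ SL₂(ℤ[1/t])` containing `ιΓ₀(L′)` and `θ(ιΓ₀(L′))` (`θ = Ad(diag(t,1)⁻¹)`): `e12_mem` (`E₁₂(x) ∈ S`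
for all `x`, via `diag(1/t,t) ∈ S` from `(q, −b; L′, t) = θ(E₁₂(−b)) θ(E₂₁(L′)) diag(1/t,t)`, `q t + b L′ = 1`),
`exists_eq_sign_mul_pow_of_mul_eq_one` (units of `ℤ[1/t]` are `± tⁱ/tᵏ`), `exists_gamma0_inv_mul_upper` (column
reduction `Γ₀(L′;ℤ[1/t]) = ιΓ₀(L′)·B⁺`, adapted from the tree's Summits-side
`ConjSpanGenAllLevels.deltaEqGamma0MulUpper`, cell bsd-f3-mu), and **`mem_of_apply_one_zero`**: every
`g ∈ SL₂(ℤ[1/t])` with `g₁₀ ∈ L′·ℤ[1/t]` lies in `S` — the «stabilisers of the two ends of the fundamental edge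
generate» half of Serre's amalgam `Γ₀(L′;ℤ[1/t]) = Γ₀(L′) *_{Γ₀(L′t)} θΓ₀(L′)` (*Trees* II §1.4 Thm. 3, Cor. 1;
I §4.1 Thm. 6).

## References

* J.-P. Serre, *Trees*, Springer (1980), Ch. I §4.1 Thm. 6, Ch. II §1.4 Thm. 3 and Cor. 1. [SerreTrees1980]
-/

noncomputable section

open scoped MatrixGroups

namespace Literature.NumberTheory.EllipticCurves

namespace Gamma0Away

open Automorphic Automorphic.SL2Rel

section Generation

variable (t : ℕ) [Fact t.Prime] {L' : ℕ}
  (S : Subgroup SL(2, Localization.Away (t : ℤ)))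
  (hS : ∀ γ : SL(2, ℤ), γ ∈ CongruenceSubgroup.Gamma0 L' →
    Matrix.SpecialLinearGroup.map (Int.castRingHom (Localization.Away (t : ℤ))) γ ∈ S)
  (hS' : ∀ γ : SL(2, ℤ), γ ∈ CongruenceSubgroup.Gamma0 L' →
    theta t (Matrix.SpecialLinearGroup.map (Int.castRingHom (Localization.Away (t : ℤ))) γ) ∈ S)

omit [Fact t.Prime] in
/-- `ι(E₁₂(z)) = E₁₂(z)`. [cite: SerreTrees1980, Ch. II §1.4] -/
theorem map_e12 (z : ℤ) :
    Matrix.SpecialLinearGroup.map (Int.castRingHom (Localization.Away (t : ℤ))) (e12 z) =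
      e12 (z : Localization.Away (t : ℤ)) := by
  ext i j; fin_cases i <;> fin_cases j <;> simp [map_apply_int]

omit [Fact t.Prime] in
/-- `ι(E₂₁(z)) = E₂₁(z)`. [cite: SerreTrees1980, Ch. II §1.4] -/
theorem map_e21 (z : ℤ) :
    Matrix.SpecialLinearGroup.map (Int.castRingHom (Localization.Away (t : ℤ))) (e21 z) =
      e21 (z : Localization.Away (t : ℤ)) := by
  ext i j; fin_cases i <;> fin_cases j <;> simp [map_apply_int]

omit [Fact t.Prime] in
/-- `θ(E₁₂(x)) = E₁₂(x/t)`. [cite: SerreTrees1980, Ch. II §1.4] -/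
theorem theta_e12 (x : Localization.Away (t : ℤ)) :
    theta t (e12 x) = e12 (x * IsLocalization.Away.invSelf (S := Localization.Away (t : ℤ)) (t : ℤ)) := by
  ext i j; fin_cases i <;> fin_cases j <;> simp [thetaAux]

omit [Fact t.Prime] in
/-- `θ(E₂₁(y)) = E₂₁(t y)`. [cite: SerreTrees1980, Ch. II §1.4] -/
theorem theta_e21 (y : Localization.Away (t : ℤ)) :
    theta t (e21 y) = e21 ((t : Localization.Away (t : ℤ)) * y) := by
  ext i j; fin_cases i <;> fin_cases j <;> simp [thetaAux]

/-- `E₁₂(z) ∈ Γ₀(L′)` and `E₂₁(L′) ∈ Γ₀(L′)` (plumbing). [cite: SerreTrees1980, Ch. II §1.4] -/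
theorem e12_mem_Gamma0 (z : ℤ) : (e12 z : SL(2, ℤ)) ∈ CongruenceSubgroup.Gamma0 L' := by
  rw [CongruenceSubgroup.Gamma0_mem]; simp

/-- `E₂₁(L′ z) ∈ Γ₀(L′)` (plumbing). [cite: SerreTrees1980, Ch. II §1.4] -/
theorem e21_mem_Gamma0 (z : ℤ) : (e21 ((L' : ℤ) * z) : SL(2, ℤ)) ∈ CongruenceSubgroup.Gamma0 L' := by
  rw [CongruenceSubgroup.Gamma0_mem]; simp

include hS in
omit [Fact t.Prime] in
/-- `E₁₂(z) ∈ S` for integers `z`. [cite: SerreTrees1980, Ch. II §1.4] -/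
theorem e12_intCast_mem (z : ℤ) : e12 (z : Localization.Away (t : ℤ)) ∈ S := by
  rw [← map_e12]; exact hS _ (e12_mem_Gamma0 z)

include hS' in
omit [Fact t.Prime] in
/-- `E₁₂(z/t) ∈ S` for integers `z`. [cite: SerreTrees1980, Ch. II §1.4] -/
theorem e12_intCast_mul_invSelf_mem (z : ℤ) :
    e12 ((z : Localization.Away (t : ℤ)) * IsLocalization.Away.invSelf (S := Localization.Away (t : ℤ)) (t : ℤ))
      ∈ S := by
  rw [← theta_e12, ← map_e12]; exact hS' _ (e12_mem_Gamma0 z)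

include hS' in
omit [Fact t.Prime] in
/-- `E₂₁(t L′) ∈ S`. [cite: SerreTrees1980, Ch. II §1.4] -/
theorem e21_natCast_mul_mem :
    e21 ((t : Localization.Away (t : ℤ)) * (L' : Localization.Away (t : ℤ))) ∈ S := by
  have h := hS' _ (e21_mem_Gamma0 (L' := L') 1)
  rw [mul_one, map_e21, theta_e21] at h
  simpa using h

omit [Fact t.Prime] in
/-- The unit `t` of `ℤ[1/t]`. [cite: SerreTrees1980, Ch. II §1.4] -/
theorem val_tUnit : ((SerreSL2.Away.isUnit_natCast_self (m := t)).unit : Localization.Away (t : ℤ)) = t :=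
  SerreSL2.Away.val_unit_natCast_self

omit [Fact t.Prime] in
/-- The inverse of the unit `t` is `1/t`. [cite: SerreTrees1980, Ch. II §1.4] -/
theorem val_tUnit_inv :
    (((SerreSL2.Away.isUnit_natCast_self (m := t)).unit⁻¹ : (Localization.Away (t : ℤ))ˣ) :
        Localization.Away (t : ℤ)) = IsLocalization.Away.invSelf (S := Localization.Away (t : ℤ)) (t : ℤ) := by
  refine Units.inv_eq_of_mul_eq_one_right ?_
  rw [val_tUnit]; exact natCast_mul_invSelf t

include hS hS' in
/-- **`diag(1/t, t) ∈ S`**: with `q t = 1 + k L′` (`t ∤ L′`), the matrix `(q, k; L′, t) ∈ Γ₀(L′)` factors as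
`θ(E₁₂(k)) · θ(E₂₁(L′)) · diag(1/t, t)` in `SL₂(ℤ[1/t])`. [cite: SerreTrees1980, Ch. II §1.4] -/
theorem diagHom_inv_mem (hL : ¬ t ∣ L') :
    diagHom ((SerreSL2.Away.isUnit_natCast_self (m := t)).unit⁻¹) ∈ S := by
  -- Bezout: `q t + b L' = 1`
  have hcop : IsCoprime (t : ℤ) (L' : ℤ) := by
    rw [Nat.isCoprime_iff_coprime]; exact (Nat.Prime.coprime_iff_not_dvd Fact.out).2 hL
  obtain ⟨q, b, hqb⟩ := hcop
  have hts := natCast_mul_invSelf t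
  let γ : SL(2, ℤ) := ⟨!![q, -b; (L' : ℤ), (t : ℤ)], by
    rw [Matrix.det_fin_two_of]; linear_combination hqb⟩
  have hγ : γ ∈ CongruenceSubgroup.Gamma0 L' := by
    rw [CongruenceSubgroup.Gamma0_mem]
    show (((L' : ℤ) : ZMod L')) = 0
    simp
  have hmem := hS γ hγ
  have hid : Matrix.SpecialLinearGroup.map (Int.castRingHom (Localization.Away (t : ℤ))) γ =
      e12 (((-b : ℤ) : Localization.Away (t : ℤ)) *
          IsLocalization.Away.invSelf (S := Localization.Away (t : ℤ)) (t : ℤ)) *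
        e21 ((t : Localization.Away (t : ℤ)) * L') *
        diagHom ((SerreSL2.Away.isUnit_natCast_self (m := t)).unit⁻¹) := by
    have hq : (q : Localization.Away (t : ℤ)) * t = 1 - (b : Localization.Away (t : ℤ)) * L' := by
      have := congrArg (fun z : ℤ => (z : Localization.Away (t : ℤ))) hqb
      push_cast at this
      linear_combination this
    ext i j
    fin_cases i <;> fin_cases j <;>
      simp only [map_apply_int, mul_apply_two, e12_apply_00, e12_apply_01, e12_apply_10, e12_apply_11,
        e21_apply_00, e21_apply_01, e21_apply_10, e21_apply_11, diagHom_apply_00, diagHom_apply_01,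
        diagHom_apply_10, diagHom_apply_11, inv_inv, val_tUnit, val_tUnit_inv, Fin.isValue, Fin.zero_eta,
        Fin.mk_one]
    · show ((q : ℤ) : Localization.Away (t : ℤ)) = _
      push_cast
      linear_combination (IsLocalization.Away.invSelf (S := Localization.Away (t : ℤ)) (t : ℤ)) * hq -
        ((q : Localization.Away (t : ℤ)) - (b : Localization.Away (t : ℤ)) * L' *
          IsLocalization.Away.invSelf (S := Localization.Away (t : ℤ)) (t : ℤ)) * hts
    · show (((-b : ℤ) : ℤ) : Localization.Away (t : ℤ)) = _
      push_cast
      linear_combination (b : Localization.Away (t : ℤ)) * hts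
    · show ((L' : ℤ) : Localization.Away (t : ℤ)) = _
      push_cast
      linear_combination -(L' : Localization.Away (t : ℤ)) * hts
    · show ((t : ℤ) : Localization.Away (t : ℤ)) = _
      push_cast; ring
  have h1 := e12_intCast_mul_invSelf_mem t S hS' (-b)
  have h2 := e21_natCast_mul_mem t S hS' (L' := L')
  rw [show diagHom ((SerreSL2.Away.isUnit_natCast_self (m := t)).unit⁻¹) =
      (e12 (((-b : ℤ) : Localization.Away (t : ℤ)) *
          IsLocalization.Away.invSelf (S := Localization.Away (t : ℤ)) (t : ℤ)) *
        e21 ((t : Localization.Away (t : ℤ)) * L'))⁻¹ *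
        Matrix.SpecialLinearGroup.map (Int.castRingHom (Localization.Away (t : ℤ))) γ by
    rw [hid, inv_mul_cancel_left]]
  exact S.mul_mem (S.inv_mem (S.mul_mem h1 h2)) hmem

include hS hS' in
/-- `diag(t, 1/t) ∈ S`. [cite: SerreTrees1980, Ch. II §1.4] -/
theorem diagHom_mem (hL : ¬ t ∣ L') : diagHom ((SerreSL2.Away.isUnit_natCast_self (m := t)).unit) ∈ S := by
  have := S.inv_mem (diagHom_inv_mem t S hS hS' hL)
  rwa [← map_inv, inv_inv] at this

include hS hS' in
/-- **`E₁₂(x) ∈ S` for every `x ∈ ℤ[1/t]`**: `x = z/tᵏ`; induction on `k` two steps at a time by conjugating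
with `diag(1/t, t)`. [cite: SerreTrees1980, Ch. II §1.4] -/
theorem e12_mem (hL : ¬ t ∣ L') (x : Localization.Away (t : ℤ)) : e12 x ∈ S := by
  obtain ⟨z, k, rfl⟩ := exists_eq_intCast_mul_invSelf_pow t x
  induction k using Nat.twoStepInduction generalizing z with
  | zero => simpa using e12_intCast_mem t S hS z
  | one => simpa using e12_intCast_mul_invSelf_mem t S hS' z
  | more k ih _ =>
    have hD := diagHom_inv_mem t S hS hS' hL
    have hconj := diagHom_conj_e12 ((SerreSL2.Away.isUnit_natCast_self (m := t)).unit⁻¹)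
      ((z : Localization.Away (t : ℤ)) * IsLocalization.Away.invSelf (S := Localization.Away (t : ℤ)) (t : ℤ) ^ k)
    rw [val_tUnit_inv] at hconj
    have : e12 ((z : Localization.Away (t : ℤ)) *
        IsLocalization.Away.invSelf (S := Localization.Away (t : ℤ)) (t : ℤ) ^ (k + 2)) =
        diagHom ((SerreSL2.Away.isUnit_natCast_self (m := t)).unit⁻¹) *
          e12 ((z : Localization.Away (t : ℤ)) * IsLocalization.Away.invSelf (S := Localization.Away (t : ℤ)) (t : ℤ) ^ k) *
          (diagHom ((SerreSL2.Away.isUnit_natCast_self (m := t)).unit⁻¹))⁻¹ := by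
      rw [hconj]; congr 1; ring
    rw [this]
    exact S.mul_mem (S.mul_mem hD (ih z)) (S.inv_mem hD)

/-- **Units of `ℤ[1/t]` are `± tⁱ / tᵏ`.** [cite: SerreTrees1980, Ch. II §1.4] -/
theorem exists_eq_sign_mul_pow_of_mul_eq_one {α δ : Localization.Away (t : ℤ)} (h : α * δ = 1) :
    ∃ (ε : ℤˣ) (i k : ℕ), α = ((ε : ℤ) : Localization.Away (t : ℤ)) * (t : Localization.Away (t : ℤ)) ^ i *
      IsLocalization.Away.invSelf (S := Localization.Away (t : ℤ)) (t : ℤ) ^ k := by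
  obtain ⟨z, k, rfl⟩ := exists_eq_intCast_mul_invSelf_pow t α
  obtain ⟨w, m, rfl⟩ := exists_eq_intCast_mul_invSelf_pow t δ
  set s := IsLocalization.Away.invSelf (S := Localization.Away (t : ℤ)) (t : ℤ) with hs
  have hts := natCast_mul_invSelf t
  -- `z w = t^(k+m)` in `ℤ`
  have h1 : ((z * w : ℤ) : Localization.Away (t : ℤ)) = (((t : ℤ) ^ (k + m) : ℤ) : Localization.Away (t : ℤ)) := by
    have e : ((z * w : ℤ) : Localization.Away (t : ℤ)) * s ^ (k + m) * (t : Localization.Away (t : ℤ)) ^ (k + m)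
        = (t : Localization.Away (t : ℤ)) ^ (k + m) := by
      have : ((z * w : ℤ) : Localization.Away (t : ℤ)) * s ^ (k + m) = 1 := by
        rw [← h]; push_cast; ring
      rw [this, one_mul]
    rw [mul_assoc, ← mul_pow, mul_comm s, hts, one_pow, mul_one] at e
    exact_mod_cast e
  have h2 : z * w = (t : ℤ) ^ (k + m) :=
    Automorphic.algebraMap_int_away_injective (Fact.out : t.Prime).ne_zero (by simpa only [eq_intCast] using h1)
  have h3 : z.natAbs ∣ t ^ (k + m) := by
    have : (z.natAbs : ℤ) ∣ (t : ℤ) ^ (k + m) := by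
      rw [Int.natAbs_dvd, ← h2]; exact dvd_mul_right z w
    exact_mod_cast this
  obtain ⟨i, -, hi⟩ := (Nat.dvd_prime_pow Fact.out).1 h3
  rcases Int.natAbs_eq z with hz | hz
  · refine ⟨1, i, k, ?_⟩
    rw [hz, hi]; push_cast; ring
  · refine ⟨-1, i, k, ?_⟩
    rw [hz, hi]; push_cast; ring

include hS hS' in
/-- A diagonal matrix of `S` with prescribed top-left entry: for every unit `α` of `ℤ[1/t]` there is
`W ∈ S` with `W₀₀ = α`, `W₀₁ = W₁₀ = 0` (namely `ι(diag(ε,ε)) · diag(t,1/t)ⁱ · diag(1/t,t)ᵏ`).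
[cite: SerreTrees1980, Ch. II §1.4] -/
theorem exists_diag_mem (hL : ¬ t ∣ L') {α δ : Localization.Away (t : ℤ)} (h : α * δ = 1) :
    ∃ W ∈ S, W 0 0 = α ∧ W 0 1 = 0 ∧ W 1 0 = 0 := by
  obtain ⟨ε, i, k, rfl⟩ := exists_eq_sign_mul_pow_of_mul_eq_one t h
  set u := (SerreSL2.Away.isUnit_natCast_self (m := t)).unit with hu
  have hε : (diagHom ε : SL(2, ℤ)) ∈ CongruenceSubgroup.Gamma0 L' := by
    rw [CongruenceSubgroup.Gamma0_mem]; simp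
  refine ⟨Matrix.SpecialLinearGroup.map (Int.castRingHom (Localization.Away (t : ℤ))) (diagHom ε) *
    diagHom (u ^ i * u⁻¹ ^ k), ?_, ?_, ?_, ?_⟩
  · refine S.mul_mem (hS _ hε) ?_
    rw [map_mul, map_pow, map_pow]
    exact S.mul_mem (S.pow_mem (diagHom_mem t S hS hS' hL) i) (S.pow_mem (diagHom_inv_mem t S hS hS' hL) k)
  · rw [mul_apply_two, map_apply_int, map_apply_int, diagHom_apply_00, diagHom_apply_01, diagHom_apply_00,
      Units.val_mul, Units.val_pow_eq_pow_val, Units.val_pow_eq_pow_val, val_tUnit, val_tUnit_inv]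
    push_cast; ring
  · rw [mul_apply_two, map_apply_int, map_apply_int, diagHom_apply_00, diagHom_apply_01, diagHom_apply_01,
      diagHom_apply_11]
    push_cast; ring
  · rw [mul_apply_two, map_apply_int, map_apply_int, diagHom_apply_10, diagHom_apply_11, diagHom_apply_00,
      diagHom_apply_10]
    push_cast; ring

/-- An integer which is a unit of `ℤ[1/t]` is `± tᵐ`. [cite: SerreTrees1980, Ch. II §1.4] -/
theorem natAbs_eq_pow_of_isUnit_intCast {d : ℤ} (hd : IsUnit ((d : ℤ) : Localization.Away (t : ℤ))) :
    ∃ m : ℕ, d.natAbs = t ^ m := by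
  obtain ⟨y, hy⟩ := hd.exists_right_inv
  obtain ⟨ε, i, k, h⟩ := exists_eq_sign_mul_pow_of_mul_eq_one t hy
  have hts := natCast_mul_invSelf t
  -- `d t^k = ε t^i` in `ℤ`
  have h1 : ((d * (t : ℤ) ^ k : ℤ) : Localization.Away (t : ℤ)) = (((ε : ℤ) * (t : ℤ) ^ i : ℤ) : Localization.Away (t : ℤ)) := by
    push_cast
    rw [h, mul_assoc, mul_assoc, ← mul_pow, mul_comm _ (t : Localization.Away (t : ℤ)), hts, one_pow, mul_one]
  have h2 : d * (t : ℤ) ^ k = (ε : ℤ) * (t : ℤ) ^ i :=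
    Automorphic.algebraMap_int_away_injective (Fact.out : t.Prime).ne_zero (by simpa only [eq_intCast] using h1)
  have h3 : d.natAbs * t ^ k = t ^ i := by
    have := congrArg Int.natAbs h2
    rw [Int.natAbs_mul, Int.natAbs_mul, Int.natAbs_pow, Int.natAbs_pow, Int.units_natAbs, one_mul] at this
    simpa using this
  have h4 : d.natAbs ∣ t ^ i := ⟨t ^ k, h3.symm⟩
  obtain ⟨m, -, hm⟩ := (Nat.dvd_prime_pow Fact.out).1 h4
  exact ⟨m, hm⟩

omit [Fact t.Prime] in
/-- Two elements of `ℤ[1/t]` have a common `t`-power denominator. [cite: SerreTrees1980, Ch. II §1.4] -/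
theorem exists_common_denom (x y : Localization.Away (t : ℤ)) :
    ∃ (e : ℕ) (x₀ y₀ : ℤ), x * (t : Localization.Away (t : ℤ)) ^ e = x₀ ∧ y * (t : Localization.Away (t : ℤ)) ^ e = y₀ := by
  obtain ⟨x₁, r, hx⟩ := SerreSL2.Away.exists_mul_pow_eq_intCast (m := t) x
  obtain ⟨y₁, r', hy⟩ := SerreSL2.Away.exists_mul_pow_eq_intCast (m := t) y
  refine ⟨r + r', x₁ * (t : ℤ) ^ r', y₁ * (t : ℤ) ^ r, ?_, ?_⟩
  · push_cast; rw [pow_add, ← mul_assoc, hx]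
  · push_cast; rw [pow_add, mul_comm ((t : Localization.Away (t : ℤ)) ^ r), ← mul_assoc, hy]

/-- **Column reduction** (`Δ = Γ₀(L′)·B⁺`): for `g ∈ SL₂(ℤ[1/t])` with `g₁₀ ∈ L′·ℤ[1/t]` (`t ∤ L′`) there is
`γ ∈ Γ₀(L′)` with `(ιγ)⁻¹ g` upper triangular (adapted from the tree's `ConjSpanGenAllLevels.deltaEqGamma0MulUpper`,
cell bsd-f3-mu). [cite: SerreTrees1980, Ch. II §1.4] -/
theorem exists_gamma0_inv_mul_upper (hL : ¬ t ∣ L') (g : SL(2, Localization.Away (t : ℤ)))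
    (hg : ∃ r : Localization.Away (t : ℤ), g 1 0 = (L' : Localization.Away (t : ℤ)) * r) :
    ∃ γ : SL(2, ℤ), γ ∈ CongruenceSubgroup.Gamma0 L' ∧
      ((Matrix.SpecialLinearGroup.map (Int.castRingHom (Localization.Away (t : ℤ))) γ)⁻¹ * g) 1 0 = 0 := by
  have ht : t.Prime := Fact.out
  obtain ⟨r, hr⟩ := hg
  obtain ⟨e, a, r₀, ha, hr₀⟩ := exists_common_denom t (g 0 0) r
  have hue : IsUnit ((t : Localization.Away (t : ℤ)) ^ e) := (SerreSL2.Away.isUnit_natCast_self (m := t)).pow e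
  have hdet := Matrix.SpecialLinearGroup.det_coe g
  rw [Matrix.det_fin_two, hr] at hdet
  have key : (a : Localization.Away (t : ℤ)) * g 1 1 - g 0 1 * ((L' : Localization.Away (t : ℤ)) * r₀) =
      (t : Localization.Away (t : ℤ)) ^ e := by
    rw [← ha, ← hr₀]
    linear_combination (t : Localization.Away (t : ℤ)) ^ e * hdet
  set G : ℕ := Int.gcd a (L' * r₀) with hG
  obtain ⟨a₀, ha₀⟩ : (G : ℤ) ∣ a := Int.gcd_dvd_left ..
  obtain ⟨c₁, hc₁⟩ : (G : ℤ) ∣ L' * r₀ := Int.gcd_dvd_right ..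
  have hGunit : IsUnit ((G : ℤ) : Localization.Away (t : ℤ)) := by
    refine isUnit_of_dvd_unit ⟨(a₀ : Localization.Away (t : ℤ)) * g 1 1 - g 0 1 * (c₁ : Localization.Away (t : ℤ)), ?_⟩ hue
    have hc₁' : ((L' : Localization.Away (t : ℤ)) * r₀) = ((G : ℤ) : Localization.Away (t : ℤ)) * c₁ := by
      exact_mod_cast congrArg (fun z : ℤ => (z : Localization.Away (t : ℤ))) hc₁
    rw [← key, hc₁', ha₀]
    push_cast
    ring
  obtain ⟨m, hm⟩ := natAbs_eq_pow_of_isUnit_intCast t hGunit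
  have hGpm : G = t ^ m := by simpa using hm
  have hGpos : 0 < G := by rw [hGpm]; exact pow_pos ht.pos m
  -- `gcd(a₀, c₁) = 1`
  have hcop : Int.gcd a₀ c₁ = 1 := by
    have h1 : G = G * Int.gcd a₀ c₁ := by
      conv_lhs => rw [hG, ha₀, hc₁, Int.gcd_mul_left]
      simp
    exact (Nat.eq_of_mul_eq_mul_left hGpos (h1.symm.trans (mul_one G).symm)).symm.symm
  -- `L' ∣ c₁`
  have hGN : IsCoprime ((G : ℕ) : ℤ) (L' : ℤ) := by
    rw [Nat.isCoprime_iff_coprime, hGpm]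
    exact Nat.Coprime.pow_left m (ht.coprime_iff_not_dvd.2 hL)
  obtain ⟨r₁, hr₁⟩ : (G : ℤ) ∣ r₀ := hGN.dvd_of_dvd_mul_left ⟨c₁, by rw [← hc₁, mul_comm]⟩
  have hc₁N : c₁ = L' * r₁ := by
    have h2 : (G : ℤ) * c₁ = (G : ℤ) * (L' * r₁) := by rw [← hc₁, hr₁]; ring
    exact mul_left_cancel₀ (by exact_mod_cast hGpos.ne') h2
  -- Bezout and the completing matrix
  obtain ⟨u, v, huv⟩ := Int.isCoprime_iff_gcd_eq_one.2 hcop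
  let γ : SL(2, ℤ) := ⟨!![a₀, -v; c₁, u], by rw [Matrix.det_fin_two_of]; linear_combination huv⟩
  have e00 : (γ : Matrix (Fin 2) (Fin 2) ℤ) 0 0 = a₀ := rfl
  have e10 : (γ : Matrix (Fin 2) (Fin 2) ℤ) 1 0 = c₁ := rfl
  have hγ : γ ∈ CongruenceSubgroup.Gamma0 L' := by
    rw [CongruenceSubgroup.Gamma0_mem, e10, hc₁N]
    push_cast
    simp
  refine ⟨γ, hγ, ?_⟩
  obtain ⟨-, -, h10, h11⟩ := inv_apply_two
    (Matrix.SpecialLinearGroup.map (Int.castRingHom (Localization.Away (t : ℤ))) γ)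
  rw [mul_apply_two, h10, h11, map_apply_int, map_apply_int, e00, e10]
  rw [← hue.mul_left_eq_zero]
  have hg10 : g 1 0 * (t : Localization.Away (t : ℤ)) ^ e = (L' : Localization.Away (t : ℤ)) * r₀ := by
    rw [hr, ← hr₀]; ring
  calc (-(c₁ : Localization.Away (t : ℤ)) * g 0 0 + (a₀ : Localization.Away (t : ℤ)) * g 1 0) *
        (t : Localization.Away (t : ℤ)) ^ e
      = -(c₁ : Localization.Away (t : ℤ)) * (g 0 0 * (t : Localization.Away (t : ℤ)) ^ e) +
          (a₀ : Localization.Away (t : ℤ)) * (g 1 0 * (t : Localization.Away (t : ℤ)) ^ e) := by ring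
    _ = -(c₁ : Localization.Away (t : ℤ)) * a + (a₀ : Localization.Away (t : ℤ)) * ((L' : Localization.Away (t : ℤ)) * r₀) := by
          rw [ha, hg10]
    _ = -(c₁ : Localization.Away (t : ℤ)) * a + (a₀ : Localization.Away (t : ℤ)) * ((L' * r₀ : ℤ) : Localization.Away (t : ℤ)) := by
          push_cast; ring
    _ = 0 := by rw [hc₁, ha₀]; push_cast; ring

include hS hS' in
/-- **Generation**: every subgroup of `SL₂(ℤ[1/t])` containing `ιΓ₀(L′)` and `θ(ιΓ₀(L′))` contains
`Γ₀(L′; ℤ[1/t]) = {g : g₁₀ ∈ L′·ℤ[1/t]}` (`t ∤ L′`). [cite: SerreTrees1980, Ch. II §1.4 Thm. 3, Cor. 1] -/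
theorem mem_of_apply_one_zero (hL : ¬ t ∣ L') (g : SL(2, Localization.Away (t : ℤ)))
    (hg : ∃ r : Localization.Away (t : ℤ), g 1 0 = (L' : Localization.Away (t : ℤ)) * r) : g ∈ S := by
  obtain ⟨γ, hγ, hb⟩ := exists_gamma0_inv_mul_upper t hL g hg
  set b := (Matrix.SpecialLinearGroup.map (Int.castRingHom (Localization.Away (t : ℤ))) γ)⁻¹ * g with hb_def
  have hbdet : b 0 0 * b 1 1 = 1 := by
    have := Matrix.det_fin_two (b : Matrix (Fin 2) (Fin 2) (Localization.Away (t : ℤ)))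
    rw [b.det_coe] at this
    have hb' : b 1 0 = 0 := hb
    rw [hb', mul_zero, sub_zero] at this
    exact this.symm
  obtain ⟨W, hW, hW00, hW01, hW10⟩ := exists_diag_mem t S hS hS' hL hbdet
  have hWdet : b 0 0 * W 1 1 = 1 := by
    have := Matrix.det_fin_two (W : Matrix (Fin 2) (Fin 2) (Localization.Away (t : ℤ)))
    rw [W.det_coe] at this
    have h01 : W 0 1 = 0 := hW01
    have h00 : W 0 0 = b 0 0 := hW00
    rw [h01, zero_mul, sub_zero, h00] at this
    exact this.symm
  -- `M = W⁻¹ b` is upper unitriangular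
  set M := W⁻¹ * b with hM_def
  obtain ⟨i00, i01, i10, i11⟩ := inv_apply_two W
  have hM : M = e12 (M 0 1) := by
    ext i j
    fin_cases i <;> fin_cases j
    · show M 0 0 = 1
      rw [hM_def, mul_apply_two, i00, i01, hW01, hb]; linear_combination hWdet
    · rfl
    · show M 1 0 = 0
      rw [hM_def, mul_apply_two, i10, i11, hW10, hb]; ring
    · show M 1 1 = 1
      rw [hM_def, mul_apply_two, i10, i11, hW10, hW00]; linear_combination hbdet
  have hMS : M ∈ S := by rw [hM]; exact e12_mem t S hS hS' hL _
  have hbS : b ∈ S := by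
    have : b = W * M := by rw [hM_def, mul_inv_cancel_left]
    rw [this]; exact S.mul_mem hW hMS
  have : g = Matrix.SpecialLinearGroup.map (Int.castRingHom (Localization.Away (t : ℤ))) γ * b := by
    rw [hb_def, mul_inv_cancel_left]
  rw [this]
  exact S.mul_mem (hS γ hγ) hbS

end Generation

end Gamma0Away

end Literature.NumberTheory.EllipticCurves

end
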